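import Summits.Ventures.QEC.Thresholds.CSSFamilyThresholds
import Literature.InformationTheory.QuantumCodes.CSSPhenomenologicalAnisotropic
import HarnessLib

/-!
# Census CSS families: certified thresholds under INHOMOGENEOUS code-capacity noise and TWO-RATE (`p ≠ q`)
# phenomenological noise — the `p₀(w-1)` and `p₀(w+1)` bounds survive with `p` replaced by the largest rate

Venture QEC, `Summits/Ventures/QEC/Thresholds/` (LADDER-QEC rung Q5 × the census object vocabulary, PARTITION row 09
"noise models"; qec-type-09 gen 4, item 09.ANISO; continues `CSSFamilyThresholds.lean`). There, for a family
`C i : CSSCode (RX i) (RZ i) (Q i)` of census objects, the `Z`- and `X`-sector code-capacity thresholds `p₀(w-1)` and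
phenomenological thresholds `p₀(w+1)` (`q = p`) are certified for every minimum-weight (space-time) decoder family.
The Literature file `CSSPhenomenologicalAnisotropic.lean` PROVES the same bounds for independent NON-identical rates and
for two phenomenological rates. Consequences (all UNCONDITIONAL, tier CERTIFIED (kernel), axioms standard, 0 facts):

| theorem | statement (hypotheses as in `CSSFamilyThresholds`: weights `≤ w`, `1 ≤ d i ≤` sector distance, subexponential size, ANY min-weight decoders) |
|---|---|
| `z_inhom_belowThreshold_of_rowWeight` / `x_…` | code capacity, link-dependent rates `0 ≤ p_{i,v} ≤ ρ < p₀(w-1)` ⇒ `Σ_{fails} w_{p_i}(e) → 0` |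
| `z_phenom_aniso_belowThreshold_of_rowWeight` / `x_…` | `T i` noisy rounds, qubit rate `p`, measurement rate `q`, `0 ≤ p, q`, `max(p,q) < p₀(w+1)` ⇒ `Prob_fail(p,q) → 0` |
So every census row's `p₀(w±1)` threshold sentence may be read with "`p`" = the largest of the (qubit / measurement /
site-dependent) rates; the region certified is a square/box (HONEST FRAMING: anisotropic decoders would do better).

## References
* [DumerKovalevPryadko2015] I. Dumer, A. A. Kovalev, L. P. Pryadko, PRL 115 (2015) 050502, Thm 2 (y = 0), Thm 3, p. 5.
* [DennisEtAl2002] E. Dennis, A. Kitaev, A. Landahl, J. Preskill, J. Math. Phys. 43 (2002) 4452, §4.2, §5.3.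
-/

noncomputable section

namespace Summit.Ventures.QEC.Thresholds

open Filter Topology Finset Matrix
open Literature.InformationTheory.QuantumCodes

variable {RX RZ Q : ℕ → Type*}

/-! ### Code capacity with site-dependent rates -/

open Classical in
/-- **`Z`-sector code-capacity threshold under inhomogeneous independent noise**: `X`-checks of weight `≤ w` (`w ≥ 2`),
`Z`-logicals of weight `≥ d i ≥ 1`, `|Q i|·r^{d i} → 0` for all `0 < r < 1`, ANY minimum-weight decoders of the
`X`-syndrome, and phase-flip rates `0 ≤ p_{i,v} ≤ ρ < p₀(w-1)`: the `Z`-failure probability tends to `0`. UNCONDITIONAL.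
[cite: DumerKovalevPryadko2015, Thm 2 (y = 0)] -/
theorem z_inhom_belowThreshold_of_rowWeight
    [∀ i, Fintype (Q i)] [∀ i, DecidableEq (Q i)] [∀ i, Fintype (RZ i)]
    (C : ∀ i, CSSCode (RX i) (RZ i) (Q i))
    (D : ∀ i, Decoder (RX i → ZMod 2) (Q i → ZMod 2))
    (hD : ∀ i, (D i).IsMinWeight (C i).zSyndrome ((C i).kerX : Set (Q i → ZMod 2)) hammingNorm)
    {w : ℕ} (hw : 2 ≤ w) (hrow : ∀ i x, (rowSupp (C i).HX x).card ≤ w) (d : ℕ → ℕ) (hd1 : ∀ i, 1 ≤ d i)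
    (hd : ∀ i (x : Q i → ZMod 2), (C i).HX *ᵥ x = 0 → x ∉ (C i).rowSpZ → d i ≤ hammingNorm x)
    (hgrowth : ∀ r : ℝ, 0 < r → r < 1 →
      Tendsto (fun i => (Fintype.card (Q i) : ℝ) * r ^ d i) atTop (𝓝 0))
    {rate : ∀ i, Q i → ℝ} {ρ : ℝ} (hr0 : ∀ i v, 0 ≤ rate i v) (hrρ : ∀ i v, rate i v ≤ ρ) (hρ0 : 0 ≤ ρ)
    (hρt : ρ < thresholdValue ((w - 1 : ℕ) : ℝ)) :
    Tendsto (fun i => ∑ e ∈ univ.filter (fun e : Q i → ZMod 2 =>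
        ¬ (D i).Corrects (C i).zSyndrome ((C i).rowSpZ : Set (Q i → ZMod 2)) e), indepWeight (rate i) (supp e))
      atTop (𝓝 0) := by
  have hK1 : (1 : ℝ) ≤ ((w - 1 : ℕ) : ℝ) := by exact_mod_cast (show 1 ≤ w - 1 by omega)
  have hρ : ρ ≤ 1 / 2 := le_trans hρt.le (thresholdValue_le_half _)
  have h4 := four_mul_sq_mul_lt_one_of_lt_thresholdValue hK1 hρt
  have hD' : ∀ i, (D i).IsMinWeight (fun e => (C i).HX *ᵥ e) {x | (C i).HX *ᵥ x = 0} hammingNorm := hD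
  exact codeCapacityThreshold_inhom_of_rowWeight' (fun i => (C i).HX) (fun i => (C i).rowSpZ) D hD' hw hrow d hd1
    hd hgrowth hr0 hrρ hρ0 hρ h4

open Classical in
/-- **`X`-sector code-capacity threshold under inhomogeneous independent noise** (bit-flip rates `p_{i,v} ≤ ρ < p₀(w-1)`,
`Z`-checks of weight `≤ w`, ANY minimum-weight decoders of the `Z`-syndrome). UNCONDITIONAL.
[cite: DumerKovalevPryadko2015, Thm 2 (y = 0)] -/
theorem x_inhom_belowThreshold_of_rowWeight
    [∀ i, Fintype (Q i)] [∀ i, DecidableEq (Q i)] [∀ i, Fintype (RX i)]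
    (C : ∀ i, CSSCode (RX i) (RZ i) (Q i))
    (D : ∀ i, Decoder (RZ i → ZMod 2) (Q i → ZMod 2))
    (hD : ∀ i, (D i).IsMinWeight (C i).xSyndrome ((C i).kerZ : Set (Q i → ZMod 2)) hammingNorm)
    {w : ℕ} (hw : 2 ≤ w) (hrow : ∀ i x, (rowSupp (C i).HZ x).card ≤ w) (d : ℕ → ℕ) (hd1 : ∀ i, 1 ≤ d i)
    (hd : ∀ i (x : Q i → ZMod 2), (C i).HZ *ᵥ x = 0 → x ∉ (C i).rowSpX → d i ≤ hammingNorm x)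
    (hgrowth : ∀ r : ℝ, 0 < r → r < 1 →
      Tendsto (fun i => (Fintype.card (Q i) : ℝ) * r ^ d i) atTop (𝓝 0))
    {rate : ∀ i, Q i → ℝ} {ρ : ℝ} (hr0 : ∀ i v, 0 ≤ rate i v) (hrρ : ∀ i v, rate i v ≤ ρ) (hρ0 : 0 ≤ ρ)
    (hρt : ρ < thresholdValue ((w - 1 : ℕ) : ℝ)) :
    Tendsto (fun i => ∑ e ∈ univ.filter (fun e : Q i → ZMod 2 =>
        ¬ (D i).Corrects (C i).xSyndrome ((C i).rowSpX : Set (Q i → ZMod 2)) e), indepWeight (rate i) (supp e))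
      atTop (𝓝 0) := by
  have hK1 : (1 : ℝ) ≤ ((w - 1 : ℕ) : ℝ) := by exact_mod_cast (show 1 ≤ w - 1 by omega)
  have hρ : ρ ≤ 1 / 2 := le_trans hρt.le (thresholdValue_le_half _)
  have h4 := four_mul_sq_mul_lt_one_of_lt_thresholdValue hK1 hρt
  have hD' : ∀ i, (D i).IsMinWeight (fun e => (C i).HZ *ᵥ e) {x | (C i).HZ *ᵥ x = 0} hammingNorm := hD
  exact codeCapacityThreshold_inhom_of_rowWeight' (fun i => (C i).HZ) (fun i => (C i).rowSpX) D hD' hw hrow d hd1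
    hd hgrowth hr0 hrρ hρ0 hρ h4

/-! ### `T` noisy rounds with qubit rate `p` and measurement rate `q` -/

/-- **`Z`-sector two-rate phenomenological threshold**: `X`-checks of weight `≤ w`, `Z`-logicals of weight `≥ d i ≥ 1`,
space-time size subexponential in the distance (`(|Q i| + |RX i|)·T i·r^{d i} → 0`), ANY minimum-weight space-time
decoders, and rates `0 ≤ p, q` with `max(p, q) < p₀(w+1)`: `Prob_fail(p, q) → 0`. UNCONDITIONAL.
[cite: DumerKovalevPryadko2015, Thm 3 with p. 5 (w → w + 2)] -/
theorem z_phenom_aniso_belowThreshold_of_rowWeight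
    [∀ i, Fintype (Q i)] [∀ i, DecidableEq (Q i)] [∀ i, Fintype (RX i)] [∀ i, DecidableEq (RX i)]
    [∀ i, Fintype (RZ i)]
    (C : ∀ i, CSSCode (RX i) (RZ i) (Q i)) (T : ℕ → ℕ)
    (D : ∀ i, CSSPhenom.STDecoder (RX i) (Q i) (T i))
    (hD : ∀ i, (D i).IsMinWeight (CSSPhenom.stSyn (C i).HX (T i)) (CSSPhenom.stCycles (C i).HX (T i))
      hammingNorm)
    {w : ℕ} (hrow : ∀ i x, (rowSupp (C i).HX x).card ≤ w) (d : ℕ → ℕ) (hd1 : ∀ i, 1 ≤ d i)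
    (hd : ∀ i (x : Q i → ZMod 2), (C i).HX *ᵥ x = 0 → x ∉ (C i).rowSpZ → d i ≤ hammingNorm x)
    (hgrowth : ∀ r : ℝ, 0 < r → r < 1 →
      Tendsto (fun i => (((Fintype.card (Q i) + Fintype.card (RX i)) * T i : ℕ) : ℝ) * r ^ d i)
        atTop (𝓝 0))
    {p q : ℝ} (hp0 : 0 ≤ p) (hq0 : 0 ≤ q) (hpq : max p q < thresholdValue ((w + 1 : ℕ) : ℝ)) :
    Tendsto (fun i => CSSPhenom.phenomFailureProb (C i).HX (T i) ((C i).rowSpZ : Set (Q i → ZMod 2)) (D i) p q)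
      atTop (𝓝 0) := by
  have hK1 : (1 : ℝ) ≤ ((w + 1 : ℕ) : ℝ) := by exact_mod_cast (show 1 ≤ w + 1 by omega)
  have hρ : max p q ≤ 1 / 2 := le_trans hpq.le (thresholdValue_le_half _)
  have h4 := four_mul_sq_mul_lt_one_of_lt_thresholdValue hK1 hpq
  exact CSSPhenom.phenomThreshold_aniso_of_rowWeight' (fun i => (C i).HX) (fun i => (C i).rowSpZ) T D hD hrow d
    hd1 hd hgrowth hp0 hq0 (le_max_left p q) (le_max_right p q) hρ h4

/-- **`X`-sector two-rate phenomenological threshold** (`Z`-checks of weight `≤ w`, `X`-logicals of weight `≥ d i`,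
`(|Q i| + |RZ i|)·T i·r^{d i} → 0`, ANY minimum-weight space-time decoders; `max(p,q) < p₀(w+1)`). UNCONDITIONAL.
[cite: DumerKovalevPryadko2015, Thm 3 with p. 5 (w → w + 2)] -/
theorem x_phenom_aniso_belowThreshold_of_rowWeight
    [∀ i, Fintype (Q i)] [∀ i, DecidableEq (Q i)] [∀ i, Fintype (RZ i)] [∀ i, DecidableEq (RZ i)]
    [∀ i, Fintype (RX i)]
    (C : ∀ i, CSSCode (RX i) (RZ i) (Q i)) (T : ℕ → ℕ)
    (D : ∀ i, CSSPhenom.STDecoder (RZ i) (Q i) (T i))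
    (hD : ∀ i, (D i).IsMinWeight (CSSPhenom.stSyn (C i).HZ (T i)) (CSSPhenom.stCycles (C i).HZ (T i))
      hammingNorm)
    {w : ℕ} (hrow : ∀ i x, (rowSupp (C i).HZ x).card ≤ w) (d : ℕ → ℕ) (hd1 : ∀ i, 1 ≤ d i)
    (hd : ∀ i (x : Q i → ZMod 2), (C i).HZ *ᵥ x = 0 → x ∉ (C i).rowSpX → d i ≤ hammingNorm x)
    (hgrowth : ∀ r : ℝ, 0 < r → r < 1 →
      Tendsto (fun i => (((Fintype.card (Q i) + Fintype.card (RZ i)) * T i : ℕ) : ℝ) * r ^ d i)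
        atTop (𝓝 0))
    {p q : ℝ} (hp0 : 0 ≤ p) (hq0 : 0 ≤ q) (hpq : max p q < thresholdValue ((w + 1 : ℕ) : ℝ)) :
    Tendsto (fun i => CSSPhenom.phenomFailureProb (C i).HZ (T i) ((C i).rowSpX : Set (Q i → ZMod 2)) (D i) p q)
      atTop (𝓝 0) := by
  have hK1 : (1 : ℝ) ≤ ((w + 1 : ℕ) : ℝ) := by exact_mod_cast (show 1 ≤ w + 1 by omega)
  have hρ : max p q ≤ 1 / 2 := le_trans hpq.le (thresholdValue_le_half _)
  have h4 := four_mul_sq_mul_lt_one_of_lt_thresholdValue hK1 hpq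
  exact CSSPhenom.phenomThreshold_aniso_of_rowWeight' (fun i => (C i).HZ) (fun i => (C i).rowSpX) T D hD hrow d
    hd1 hd hgrowth hp0 hq0 (le_max_left p q) (le_max_right p q) hρ h4

end Summit.Ventures.QEC.Thresholds

end
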